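import Summits.PneNP.PneNP.Theorems.ChebyshevTracialDesignJuntaLowDegree
import Literature.Computability.Complexity.KnapsackSosDegree
import HarnessLib

/-!
# Cell pnp-psdrank, route `ChebyshevTracialDesign`: the low-degree sector is unconditional

`Literature.Combinatorics.Optimization.DesignValueNonposLowDegree` (planner p1 ROUND-3 §2.15, p408849: the design value of a
psd strategy whose CUT-side factor has Johnson degree `≤ k` with `2k ≤ D`, `4k ≤ t` is `≤ 0`) was proved by prover g2
CONDITIONALLY on Grigoriev's knapsack positivity (`designValueNonposLowDegree_of_knapsack`, p416391); the literature seat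
has since DISCHARGED that named fact (`Literature.Computability.Complexity.Grigoriev2001_knapsackFormNonneg_holds`, p419297,
Grigoriev 2001 Lemma 1.4 via the Johnson-scheme ladder calculus). Composition: the statement holds outright.
WHAT THIS IS NOT: no bearing on the spread sector / stub VIRT of the crux `TracialDecayExp20` (stmt-PneNP-19878).
-/

set_option linter.dupNamespace false -- `Summit.PneNP.PneNP.…`: summit = sub-problem (D-0017)

namespace Summit.PneNP.PneNP.Theorems.ChebyshevTracialDesignJunta

/-- **`DesignValueNonposLowDegree` holds** (unconditionally): p416391 composed with the tree's discharge of Grigoriev 2001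
Lemma 1.4. [cite: Grigoriev2001, Lemma 1.4 (PDF p. 8)] -/
theorem DesignValueNonposLowDegree_holds : Literature.Combinatorics.Optimization.DesignValueNonposLowDegree :=
  designValueNonposLowDegree_of_knapsack
    Literature.Computability.Complexity.Grigoriev2001_knapsackFormNonneg_holds

end Summit.PneNP.PneNP.Theorems.ChebyshevTracialDesignJunta
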